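import Mathlib
import HarnessLib
import Summits.HubbardSuperconductivity.HubbardSuperconductivity.Theorems.KLProgrammeKLRegimeSectorGramSoftShapedFat
import Summits.HubbardSuperconductivity.HubbardSuperconductivity.Theorems.KLProgrammeKLRegimeSectorSliceGramRegime

/-!
# Route `KLProgramme` — ENGINE child gen 8 (stmt-HubbardSuperconductivity-20437 `KLRegimeEngineV17F2`), skeleton v2 class #3 witness input GAP L2-c:
# β-UNIFORM line data (entry `δ`, Gram half-norms `κ`, replica-Gram constant) of the fat-sectorised line of ANY SOFT-SHAPED symbol IN THE KL REGIME —
# `≤ A_p·Cκ·e₀·8^{-n}` (cell gate-hubbard-kl, seat hubbard-kl-k3c2-p2 g9, value/(T) lane; p5 l.3059 `hent` / `hκF` / `hκG` for the DRESSED soft line)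

p5's class-#3 bridge (…EngineV8E5Block / …E5BlockLabels, instance of record `F = klAnisoFamily … (m+1)`, `F̃ = bgmFatMultiplier … (m+1)`) consumes, for the
soft line `s₁`, an entry bound `hent` and Gram half-norm bounds `hκF/hκG` of `S(F̃)ᵀ·normalCovariance (sym s₁)·S(F̃)`, where `sym s₁ = klE5SoftLineSym …` is the
DRESSED soft symbol: by `norm_klE5SoftLineSym_le` it is soft-shaped, `‖sym s₁ (ks)‖ ≤ 8·βL²/ρ_K(ks)` (each of its three pieces is a cutoff weight of modulus
`≤ 1` times `βL²(iω + e_K)/den`, `norm_sliceSymbolCT_le_div_radius`-type).  This file gives the β-UNIFORM data for ANY symbol with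
`‖p(ks)‖ ≤ A_p·βL²/√(ω² + e_K²)` where `p(ks) ≠ 0` (no support hypothesis: the fat multiplier's own support `π/β ≤ ρ_K ≤ Λ_m` bounds the dyadic range):
the regime bookkeeping of …SectorSliceGramSoftSharp (frame data from `FrameOK`, coordinate-gradient floor `λ = (1/2)/√2`, `ρ_f ≤ c_ρπ/2^{m+1}`,
`2^{m+1} ≤ β ≤ L`) applied to …SectorGramSoftShapedFat:

* **`gram_softShaped_bgmFat_sharp_of_thresholds`** — `∃ Cκ > 0` (absolute): in the regime, for every `m ≤ nScales β`, every symbol `p` and `A_p ≥ 0` with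
  the soft shape: entries `≤ A_p·Cκ·e₀·8^{-(m+1)}`, `IsGramBoundedR … √(A_p·Cκ·e₀·8^{-(m+1)})`, `‖F_Y‖, ‖G_{Y′}‖ ≤ √(A_p·Cκ·e₀·8^{-(m+1)})`;
* **`gram_softShaped_bgmFat_sharp_klEng`** — the same under EXACTLY the stub binders (`klEngC₃3 / klEngU₀4 / klEngL₃ / klEngM₃`), fat index `1 ≤ n ≤ nScales β + 1`.

Everything is proved; no definitions, no named facts.  References (locators only): Benfatto–Giuliani–Mastropietro, Ann. Henri Poincaré 7 (2006)
§2.7 (2.66)–(2.67), §2.8 (2.80).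
-/

noncomputable section

namespace Summit.HubbardSuperconductivity.HubbardSuperconductivity.Theorems.TorusFourierL2

set_option linter.dupNamespace false -- summit = problem name (single-conjunct summit), D-0017

open Set Finset Literature.MathematicalPhysics.QuantumLattice Literature.MathematicalPhysics.QuantumLattice.BandSectorCounting
open Literature.MathematicalPhysics.QuantumLattice.FermiRG Literature.Probability.LatticeModels Literature.Analysis.SpecialFunctions
open Summit.HubbardSuperconductivity.HubbardSuperconductivity.Theorems.DispersionFlow
open Summit.HubbardSuperconductivity.HubbardSuperconductivity.Theorems.KLRegimeSplit
open Summit.HubbardSuperconductivity.HubbardSuperconductivity.Theorems.KLProgrammeLegKernels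
open Summit.HubbardSuperconductivity.HubbardSuperconductivity.Theorems.PerturbedFermiCurve
open Summit.HubbardSuperconductivity.HubbardSuperconductivity.Theorems.KLRegimeWick
open scoped Real

/-! ## §1 Thresholds exposed -/

/-- **β-UNIFORM line data of the fat-sectorised line of a soft-shaped symbol in the KL regime** (thresholds `κ₀` of `B = bandBounds (−6/5) (−1/10)`
exposed): there is an absolute `Cκ > 0` such that for every `R` (`Gfr ≥ 0`), `0 < c ≤ κ₀/(12(Gfr₂+1))`, `0 < U ≤ min 1 (κ₀/(24(Gfr₀+Gfr₁+1)))`,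
`klBetaMin ≤ β ≤ e^{c/U²}`, `μ ∈ klWindowC`, `FrameOK R U (nScales β) μ K`, `β² ≤ L`, every `m ≤ nScales β`, and every symbol `p` with
`‖p(ks)‖ ≤ A_p·βL²/√(ω² + e_K²)` where `p(ks) ≠ 0` (`A_p ≥ 0`): the entries of `S(Ft)ᵀ·normalCovariance p·S(Ft)` (`Ft = bgmFatMultiplier … klE0 … (m+1)`)
are `≤ A_p·Cκ·(klE0·8^{-(m+1)})`, the matrix is replica-Gram-bounded with the square root of that number, and both Gram half-norms are below the same
square root. [cite: BenfattoGiulianiMastropietro2006, §2.8 (2.80)] -/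
theorem gram_softShaped_bgmFat_sharp_of_thresholds (ha : (-4 : ℝ) < -(6 / 5)) (hab : (-(6 / 5) : ℝ) ≤ -(1 / 10)) (hb : (-(1 / 10) : ℝ) < 0) :
    ∃ Cκ : ℝ, 0 < Cκ ∧ ∀ (R : RenConsts), (∀ j, 0 ≤ R.Gfr j) →
      ∀ (c U : ℝ), 0 < c →
      c ≤ min (min ((bandBounds ha hab hb).Dtmin / 4) ((bandBounds ha hab hb).rhomin / 4)) (1 / 40) / (12 * (R.Gfr 2 + 1)) → 0 < U →
      U ≤ min 1 (min (min ((bandBounds ha hab hb).Dtmin / 4) ((bandBounds ha hab hb).rhomin / 4)) (1 / 40) / (24 * (R.Gfr 0 + R.Gfr 1 + 1))) →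
      ∀ β : ℝ, klBetaMin ≤ β → β ≤ Real.exp (c / U ^ 2) → ∀ μ ∈ klWindowC, ∀ K : TrigPolyC4v, FrameOK R U (nScales β) μ K →
      ∀ (L M : ℕ) [NeZero L] [NeZero M], β ^ 2 ≤ (L : ℝ) → ∀ m : ℕ, m ≤ nScales β →
      ∀ (p : FreqMomentum L M × Fin 2 → ℂ) (Ap : ℝ), 0 ≤ Ap →
      (∀ ks, p ks ≠ 0 → ‖p ks‖ ≤ Ap * (β * (L : ℝ) ^ 2) / Real.sqrt (matsubaraFreq β M ks.1.1 ^ 2 + nambuXiCT L μ K ks.1.2 ^ 2)) →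
        (∀ Y Y' : SpaceTimeIdx L M × SectorLeg (sectorCount (m + 1)),
          ‖((sectorSubMatrix L M β (bgmFatMultiplier L M klE0 β (nambuXiCT L μ K) (m + 1))).transpose *
              normalCovariance L M p * sectorSubMatrix L M β (bgmFatMultiplier L M klE0 β (nambuXiCT L μ K) (m + 1))) Y Y'‖ ≤
            Ap * Cκ * (klE0 * ((8 : ℝ) ^ (m + 1))⁻¹)) ∧
        IsGramBoundedR ((sectorSubMatrix L M β (bgmFatMultiplier L M klE0 β (nambuXiCT L μ K) (m + 1))).transpose *
              normalCovariance L M p * sectorSubMatrix L M β (bgmFatMultiplier L M klE0 β (nambuXiCT L μ K) (m + 1)))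
          (Real.sqrt (Ap * Cκ * (klE0 * ((8 : ℝ) ^ (m + 1))⁻¹))) ∧
        (∀ Y : SpaceTimeIdx L M × SectorLeg (sectorCount (m + 1)),
          ‖sectorGramF L M β (bgmFatMultiplier L M klE0 β (nambuXiCT L μ K) (m + 1)) p Y‖ ≤ Real.sqrt (Ap * Cκ * (klE0 * ((8 : ℝ) ^ (m + 1))⁻¹))) ∧
        (∀ Y' : SpaceTimeIdx L M × SectorLeg (sectorCount (m + 1)),
          ‖sectorGramG L M β (bgmFatMultiplier L M klE0 β (nambuXiCT L μ K) (m + 1)) p Y'‖ ≤ Real.sqrt (Ap * Cκ * (klE0 * ((8 : ℝ) ^ (m + 1))⁻¹))) := by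
  -- the window band bounds and the absolute frame-size threshold (as in `gram_entry_sliceCT_bgmFat_of_thresholds`)
  set B : BandBounds (-(6 / 5)) (-(1 / 10)) := bandBounds ha hab hb with hBdef
  set κ₀ : ℝ := min (min (B.Dtmin / 4) (B.rhomin / 4)) (1 / 40) with hκ₀
  have hDt := B.Dtmin_pos
  have hrh := B.rhomin_pos
  have hκ₀pos : 0 < κ₀ := by rw [hκ₀]; exact lt_min (lt_min (by positivity) (by positivity)) (by norm_num)
  have hκ₀Dt : κ₀ ≤ B.Dtmin / 4 := (min_le_left _ _).trans (min_le_left _ _)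
  have hκ₀rh : κ₀ ≤ B.rhomin / 4 := (min_le_left _ _).trans (min_le_right _ _)
  have hκ₀40 : κ₀ ≤ 1 / 40 := min_le_right _ _
  have hrh2 : B.rhomin ≤ 2 := by
    have : B.rhomin = cRhomin (-(6 / 5)) (-(1 / 10)) := rfl
    rw [this]; exact cRhomin_le_two (by norm_num) (by norm_num)
  have he : (0 : ℝ) < klE0 := by norm_num [klE0]
  -- the absolute constant
  set A : ℝ := κ₀ / 4 with hAdef
  have hA0 : 0 < A := by rw [hAdef]; positivity
  have hDtA : 0 < B.Dtmin - 2 * A := by rw [hAdef]; linarith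
  have hsm := B.smax_pos
  have hπ := Real.pi_pos
  have hπ3 := Real.pi_gt_three
  obtain ⟨cρ, hcρ⟩ : ∃ cρ : ℝ, cρ = (2 * klE0 / π + B.smax * B.Dtmin * (3 / 4)) / (B.Dtmin - 2 * A) +
      π * Real.sqrt 2 * (1 + (4 + 2 * A) / (B.Dtmin - 2 * A)) := ⟨_, rfl⟩
  obtain ⟨Kp, hKp⟩ : ∃ Kp : ℝ, Kp = 4 + 4 * A := ⟨_, rfl⟩
  -- the coordinate-gradient floor `λ = (1/2)/√2` of an admissible frame band (`GeomConstants … (1/2) …`)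
  obtain ⟨lam, hlam⟩ : ∃ lam : ℝ, lam = (1 / 2 : ℝ) / Real.sqrt 2 := ⟨_, rfl⟩
  have hlam0 : 0 < lam := by rw [hlam]; positivity
  obtain ⟨Q₁, hQ₁⟩ : ∃ Q₁ : ℝ, Q₁ = 8 * π * Kp / lam + 1 := ⟨_, rfl⟩
  obtain ⟨Cκ, hCκ⟩ : ∃ Cκ : ℝ, Cκ = 64 * Q₁ * (4 / (π * lam) + 2 / π) * cρ / π := ⟨_, rfl⟩
  have hcρ0 : 0 < cρ := by rw [hcρ]; positivity
  have hKp0 : 0 < Kp := by rw [hKp]; positivity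
  have hQ₁0 : 0 < Q₁ := by rw [hQ₁]; positivity
  have hCκ0 : 0 < Cκ := by rw [hCκ]; positivity
  refine ⟨4 * Cκ, by positivity, ?_⟩
  intro R hR c U hc hcle hU hUle β hβmin hβc μ hμ K hK L M _ _ hLβ m hmN p Ap hAp hp
  have hβ0 : 0 < β := pos_of_klBetaMin_le hβmin
  have hβ128 : 128 ≤ β := by simpa [klBetaMin] using hβmin
  have hL0 : (0 : ℝ) < L := lt_of_lt_of_le (by positivity) hLβ
  -- the frame's `C²` size is `≤ A = κ₀/4`
  have hlog : 1 ≤ Real.log 4 := by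
    have h4 : Real.exp 1 ≤ 4 := by have := Real.exp_one_lt_d9; norm_num at this; linarith
    calc (1 : ℝ) = Real.log (Real.exp 1) := (Real.log_exp 1).symm
      _ ≤ Real.log 4 := Real.log_le_log (Real.exp_pos 1) h4
  have hAK : ∀ p : Momentum, ∀ j ≤ 2, ‖iteratedFDeriv ℝ j (frameShift K) p‖ ≤ A := by
    intro p j hj
    refine (norm_iteratedFDeriv_frameShift_le_of_frameOK_regime hR hc.le hβmin hβc hK p hj).trans ?_
    have h0 := hR 0; have h1 := hR 1; have h2 := hR 2
    have hU1 : U ≤ 1 := hUle.trans (min_le_left _ _)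
    have hUk : U ≤ κ₀ / (24 * (R.Gfr 0 + R.Gfr 1 + 1)) := hUle.trans (min_le_right _ _)
    rw [abs_of_pos hU]
    have hU2 : U ^ 2 ≤ U := by nlinarith only [hU, hU1]
    have hA1 : 2 * R.Gfr 0 * U + 2 * R.Gfr 1 * U ^ 2 ≤ 2 * (R.Gfr 0 + R.Gfr 1 + 1) * U := by
      have := mul_le_mul_of_nonneg_left hU2 h1
      linarith only [this, hU.le]
    have hB1 : 2 * (R.Gfr 0 + R.Gfr 1 + 1) * U ≤ κ₀ / 12 := by
      have hpos : 0 < 24 * (R.Gfr 0 + R.Gfr 1 + 1) := by positivity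
      have := (le_div_iff₀ hpos).mp hUk
      linarith only [this]
    have hC1 : R.Gfr 2 * (c / Real.log 4) ≤ R.Gfr 2 * c := mul_le_mul_of_nonneg_left (div_le_self hc.le hlog) h2
    have hD1 : R.Gfr 2 * c ≤ κ₀ / 12 := by
      have hpos : 0 < 12 * (R.Gfr 2 + 1) := by positivity
      have := (le_div_iff₀ hpos).mp hcle
      linarith only [this, hc.le]
    rw [hAdef]; linarith only [hA1, hB1, hC1, hD1, hκ₀pos]
  -- the window margins
  have hμ' := hμ
  simp only [klWindowC, Set.mem_Icc] at hμ'
  have e1 : (-1.05 : ℝ) = -(21 / 20) := by norm_num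
  have e2 : (-0.15 : ℝ) = -(3 / 20) := by norm_num
  have hμlo : -(21 / 20 : ℝ) ≤ μ := by rw [← e1]; exact hμ'.1
  have hμhi : μ ≤ -(3 / 20 : ℝ) := by rw [← e2]; exact hμ'.2
  have he0 : klE0 = 1 / 32 := rfl
  have hgap : klE0 + A + (1 / 10 : ℝ) ^ 2 < -μ := by rw [he0, hAdef]; linarith only [hμhi, hκ₀40]
  have hlo : (-(6 / 5) : ℝ) ≤ μ - A - klE0 := by rw [he0, hAdef]; linarith only [hμlo, hκ₀40]
  have hhi : μ + A + klE0 ≤ -(1 / 10) := by rw [he0, hAdef]; linarith only [hμhi, hκ₀40]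
  have hADt : 2 * A < B.Dtmin := by rw [hAdef]; linarith
  -- the scales: `Λg = Λ_{m+1}`, `Λ_m = 4Λg`, `N_r = 2^{m+1}`, `N_r²Λg = e₀`
  set Λg : ℝ := klScale klE0 (m + 1) with hΛgdef
  set Nr : ℝ := (2 : ℝ) ^ (m + 1) with hNrdef
  have hΛg0 : 0 < Λg := klth_klScale_pos (m + 1)
  have hNr2 : 2 ≤ Nr := by
    rw [hNrdef]
    calc (2 : ℝ) = 2 ^ 1 := by norm_num
      _ ≤ 2 ^ (m + 1) := pow_le_pow_right₀ (by norm_num) (by omega)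
  have hNr0 : 0 < Nr := by linarith only [hNr2]
  have hNrsq : Nr ^ 2 = (4 : ℝ) ^ (m + 1) := by
    rw [hNrdef, ← pow_mul, show (4 : ℝ) = 2 ^ 2 by norm_num, ← pow_mul]; ring_nf
  have hNrΛ : Nr ^ 2 * Λg = klE0 := by rw [hNrsq, hΛgdef, klScale]; field_simp
  have hΛm : klScale klE0 m = 4 * Λg := by rw [hΛgdef, klScale, klScale, pow_succ]; field_simp
  have hNrΛ' : Nr * Λg ≤ klE0 / 2 := by
    have : Nr * Λg = klE0 / Nr := by
      rw [eq_div_iff hNr0.ne', ← hNrΛ]; ring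
    rw [this]; exact div_le_div_of_nonneg_left he.le (by norm_num) hNr2
  have hw : sectorWidth (m + 1) = π / Nr := by rw [sectorWidth, hNrdef]
  have hanti : ∀ {a b : ℕ}, a ≤ b → klScale klE0 b ≤ klScale klE0 a := fun hab' => by
    unfold klScale; exact mul_le_mul_of_nonneg_left (inv_anti₀ (by positivity) (pow_le_pow_right₀ (by norm_num) hab')) he.le
  have hΛmβ : π / β ≤ klScale klE0 m := (klth_pi_div_le_klScale_nScales hβmin).trans (hanti hmN)
  have h4m : (4 : ℝ) ^ m ≤ klE0 * β / π := by
    have h4pos : (0 : ℝ) < (4 : ℝ) ^ m := by positivity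
    have h1 : π / β ≤ klE0 * ((4 : ℝ) ^ m)⁻¹ := by simpa [klScale] using hΛmβ
    rw [le_div_iff₀ hπ]
    rw [div_le_iff₀ hβ0] at h1
    have : π * (4 : ℝ) ^ m ≤ klE0 * ((4 : ℝ) ^ m)⁻¹ * β * (4 : ℝ) ^ m := mul_le_mul_of_nonneg_right h1 h4pos.le
    have e : klE0 * ((4 : ℝ) ^ m)⁻¹ * β * (4 : ℝ) ^ m = klE0 * β := by field_simp
    linarith only [this, e]
  have hNrβ : Nr ≤ β := by
    have h2le4 : Nr ≤ 2 * (4 : ℝ) ^ m := by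
      rw [hNrdef, pow_succ, mul_comm]
      exact mul_le_mul_of_nonneg_left (pow_le_pow_left₀ (by norm_num) (by norm_num) m) (by norm_num)
    have h' : 2 * (klE0 * β / π) ≤ β := by
      rw [he0, mul_div_assoc', div_le_iff₀ hπ]; nlinarith only [hπ3, hβ0]
    linarith only [h2le4, h4m, h']
  have hNrL : Nr ≤ (L : ℝ) := hNrβ.trans ((le_self_pow₀ (by linarith only [hβ128]) two_ne_zero).trans hLβ)
  -- the cell radius `ρ_f ≤ c_ρ π / N_r` and the shell thickness (as in `slicePair_bgmFat_closed`)
  set ρf : ℝ := (klScale klE0 m + B.smax * B.Dtmin * (3 * sectorWidth (m + 1) / 4)) / (B.Dtmin - 2 * A) +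
    π * Real.sqrt 2 * (1 + (4 + 2 * A) / (B.Dtmin - 2 * A)) * sectorWidth (m + 1) with hρf
  have hΛm0 : 0 < klScale klE0 m := klth_klScale_pos m
  have hρf0 : 0 ≤ ρf := by rw [hρf]; have := sectorWidth_pos (m + 1); positivity
  have hρfb : ρf ≤ cρ * π / Nr := by
    rw [hρf, hcρ, hw, hΛm]
    have h4Λ : 4 * Λg ≤ 2 * klE0 / π * (π / Nr) := by
      have e : 2 * klE0 / π * (π / Nr) = 2 * klE0 / Nr := by field_simp
      rw [e, le_div_iff₀ hNr0]
      have := mul_le_mul_of_nonneg_left hNrΛ' (by norm_num : (0:ℝ) ≤ 4)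
      linarith only [this]
    have e2 : ((2 * klE0 / π + B.smax * B.Dtmin * (3 / 4)) / (B.Dtmin - 2 * A) + π * Real.sqrt 2 * (1 + (4 + 2 * A) / (B.Dtmin - 2 * A))) * π / Nr =
        (2 * klE0 / π * (π / Nr) + B.smax * B.Dtmin * (3 * (π / Nr) / 4)) / (B.Dtmin - 2 * A) +
          π * Real.sqrt 2 * (1 + (4 + 2 * A) / (B.Dtmin - 2 * A)) * (π / Nr) := by
      field_simp
    rw [e2]
    gcongr
  -- the `+1` threshold of the transverse count: `π ≤ ρ_f·L`
  have hρfw : π * Real.sqrt 2 * (π / Nr) ≤ ρf := by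
    rw [hρf, hw]
    have h1 : 0 ≤ (klScale klE0 m + B.smax * B.Dtmin * (3 * (π / Nr) / 4)) / (B.Dtmin - 2 * A) := by
      have := klth_klScale_pos m; positivity
    have h2 : π * Real.sqrt 2 * (π / Nr) ≤ π * Real.sqrt 2 * (1 + (4 + 2 * A) / (B.Dtmin - 2 * A)) * (π / Nr) := by
      have hx : (1 : ℝ) ≤ 1 + (4 + 2 * A) / (B.Dtmin - 2 * A) := le_add_of_nonneg_right (by positivity)
      have h0 : 0 ≤ π * Real.sqrt 2 * (π / Nr) := by positivity
      calc π * Real.sqrt 2 * (π / Nr) = π * Real.sqrt 2 * 1 * (π / Nr) := by ring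
        _ ≤ π * Real.sqrt 2 * (1 + (4 + 2 * A) / (B.Dtmin - 2 * A)) * (π / Nr) := by gcongr
    linarith only [h1, h2]

  -- the coordinate-gradient floor of the frame band on the shell `{|e_K| ≤ Λ_m}` (inside the tube `{|e_K| < 3/80}`)
  have hgradK : ∀ p : Fin 2 → ℝ, |frameLevel μ K (WithLp.toLp 2 p)| ≤ klScale klE0 m →
      lam ≤ |fderiv ℝ (fun q : Fin 2 → ℝ => frameLevel μ K (WithLp.toLp 2 q)) p (Pi.single 0 1)| ∨
        lam ≤ |fderiv ℝ (fun q : Fin 2 → ℝ => frameLevel μ K (WithLp.toLp 2 q)) p (Pi.single 1 1)| := by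
    intro p hp
    have htube : |frameLevel μ K (WithLp.toLp 2 p)| < 3 / 80 :=
      lt_of_le_of_lt (hp.trans (klScale_le_e0 he.le m)) (by norm_num [klE0])
    rw [hlam]
    exact coord_floor_of_le_norm_gradient ((EngineV8.contDiff_frameLevel μ K (n := 1)).differentiable one_ne_zero) (by norm_num) p
      (hK.1.le_norm_gradient _ htube)
  have hgap0 : klE0 + A < -μ := by linarith only [hgap]
  have hΛ'0 : 0 < Λg := hΛg0
  -- the β-uniform bound of …SectorSliceGramFatAnnulus and its value in the regime
  have hnorm : ‖((1 / (β * (L : ℝ) ^ 2) : ℝ) : ℂ)‖ ^ 2 = (1 / (β * (L : ℝ) ^ 2)) ^ 2 := by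
    rw [Complex.norm_real, Real.norm_eq_abs, abs_of_pos (by positivity)]
  have hE : ‖((1 / (β * (L : ℝ) ^ 2) : ℝ) : ℂ)‖ ^ 2 * (4 * (β * (L : ℝ) ^ 2) *
        ((8 * β / π) * (ρf * L / π + 1) * ((8 * π * (4 + 4 * A) / lam + 1) * (4 * L / (π * lam) + 2 * β / π))) * Λg) ≤
      Cκ * (Λg / Λg) * (klE0 * ((8 : ℝ) ^ (m + 1))⁻¹) := by
    rw [hnorm, ← hKp, ← hQ₁]
    have e1 : (1 / (β * (L : ℝ) ^ 2)) ^ 2 * (4 * (β * (L : ℝ) ^ 2) * ((8 * β / π) * (ρf * L / π + 1) * (Q₁ * (4 * L / (π * lam) + 2 * β / π))) * Λg) =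
        32 * (ρf * L / π + 1) * Q₁ * (4 * L / (π * lam) + 2 * β / π) * Λg / (π * (L : ℝ) ^ 2) := by
      field_simp
      ring
    rw [e1]
    have hD : ρf * L / π + 1 ≤ 2 * ρf * L / π := by
      have h1 : π ≤ ρf * L := by
        have h2 : π * Real.sqrt 2 * (π / Nr) * Nr ≤ ρf * L := mul_le_mul hρfw hNrL hNr0.le hρf0
        have e : π * Real.sqrt 2 * (π / Nr) * Nr = π * (Real.sqrt 2 * π) := by field_simp
        have hs1 : 1 ≤ Real.sqrt 2 := by
          rw [show (1 : ℝ) = Real.sqrt 1 by simp]; exact Real.sqrt_le_sqrt (by norm_num)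
        have h3 : (1 : ℝ) ≤ Real.sqrt 2 * π :=
          calc (1 : ℝ) ≤ 1 * 3 := by norm_num
            _ ≤ Real.sqrt 2 * π := mul_le_mul hs1 hπ3.le (by norm_num) (by positivity)
        have h4 : π * 1 ≤ π * (Real.sqrt 2 * π) := mul_le_mul_of_nonneg_left h3 hπ.le
        rw [e] at h2
        linarith only [h2, h4]
      rw [div_add_one hπ.ne', div_le_div_iff_of_pos_right hπ]
      linarith only [h1]
    have hW : 4 * L / (π * lam) + 2 * β / π ≤ (4 / (π * lam) + 2 / π) * L := by
      have hβL : β ≤ (L : ℝ) := (le_self_pow₀ (by linarith only [hβ128]) two_ne_zero).trans hLβ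
      have e : (4 / (π * lam) + 2 / π) * L = 4 * L / (π * lam) + 2 * L / π := by ring
      rw [e]
      have : 2 * β / π ≤ 2 * L / π := by gcongr
      linarith only [this]
    have step1 : 32 * (ρf * L / π + 1) * Q₁ * (4 * L / (π * lam) + 2 * β / π) * Λg / (π * (L : ℝ) ^ 2) ≤
        32 * (2 * ρf * L / π) * Q₁ * ((4 / (π * lam) + 2 / π) * L) * Λg / (π * (L : ℝ) ^ 2) := by
      gcongr
    have e2 : 32 * (2 * ρf * L / π) * Q₁ * ((4 / (π * lam) + 2 / π) * L) * Λg / (π * (L : ℝ) ^ 2) =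
        64 * Q₁ * (4 / (π * lam) + 2 / π) / π ^ 2 * (ρf * Λg) := by
      field_simp
      ring
    have step2 : ρf * Λg ≤ cρ * π / Nr * Λg := mul_le_mul_of_nonneg_right hρfb hΛg0.le
    have e3 : cρ * π / Nr * Λg = cρ * π * (Λg / Λg) * (Λg / Nr) := by field_simp
    have e4 : Λg / Nr = klE0 * ((8 : ℝ) ^ (m + 1))⁻¹ := by rw [hΛgdef, hNrdef]; exact klScale_div_two_pow klE0 m
    have hpre : 0 ≤ 64 * Q₁ * (4 / (π * lam) + 2 / π) / π ^ 2 := by positivity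
    calc 32 * (ρf * L / π + 1) * Q₁ * (4 * L / (π * lam) + 2 * β / π) * Λg / (π * (L : ℝ) ^ 2)
        ≤ 32 * (2 * ρf * L / π) * Q₁ * ((4 / (π * lam) + 2 / π) * L) * Λg / (π * (L : ℝ) ^ 2) := step1
      _ = 64 * Q₁ * (4 / (π * lam) + 2 / π) / π ^ 2 * (ρf * Λg) := e2
      _ ≤ 64 * Q₁ * (4 / (π * lam) + 2 / π) / π ^ 2 * (cρ * π / Nr * Λg) := mul_le_mul_of_nonneg_left step2 hpre
      _ = Cκ * (Λg / Λg) * (klE0 * ((8 : ℝ) ^ (m + 1))⁻¹) := by rw [e3, e4, hCκ]; field_simp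
  have hE' : ‖((1 / (β * (L : ℝ) ^ 2) : ℝ) : ℂ)‖ ^ 2 * (4 * (Ap * (β * (L : ℝ) ^ 2)) *
        ((8 * β / π) * (((klScale klE0 m + B.smax * B.Dtmin * (3 * sectorWidth (m + 1) / 4)) / (B.Dtmin - 2 * A) +
              π * Real.sqrt 2 * (1 + (4 + 2 * A) / (B.Dtmin - 2 * A)) * sectorWidth (m + 1)) * L / π + 1) *
          ((8 * π * (4 + 4 * A) / lam + 1) * (4 * L / (π * lam) + 2 * β / π))) * klScale klE0 m) ≤
      Ap * (4 * Cκ) * (klE0 * ((8 : ℝ) ^ (m + 1))⁻¹) := by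
    rw [← hρf, hΛm]
    have hdiv : Λg / Λg = 1 := div_self hΛg0.ne'
    rw [hdiv, mul_one] at hE
    calc ‖((1 / (β * (L : ℝ) ^ 2) : ℝ) : ℂ)‖ ^ 2 * (4 * (Ap * (β * (L : ℝ) ^ 2)) *
          ((8 * β / π) * (ρf * L / π + 1) * ((8 * π * (4 + 4 * A) / lam + 1) * (4 * L / (π * lam) + 2 * β / π))) * (4 * Λg))
        = 4 * Ap * (‖((1 / (β * (L : ℝ) ^ 2) : ℝ) : ℂ)‖ ^ 2 * (4 * (β * (L : ℝ) ^ 2) *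
          ((8 * β / π) * (ρf * L / π + 1) * ((8 * π * (4 + 4 * A) / lam + 1) * (4 * L / (π * lam) + 2 * β / π))) * Λg)) := by ring
      _ ≤ 4 * Ap * (Cκ * (klE0 * ((8 : ℝ) ^ (m + 1))⁻¹)) := mul_le_mul_of_nonneg_left hE (by positivity)
      _ = Ap * (4 * Cκ) * (klE0 * ((8 : ℝ) ^ (m + 1))⁻¹) := by ring
  refine ⟨fun Y Y' => ?_, ?_, fun Y => ?_, fun Y' => ?_⟩
  · exact (norm_entry_softShaped_bgmFat_sharp_le (L := L) (M := M) B hAK hADt he hgap0 hlo hhi hβ0 m hlam0 hgradK p hAp hp Y Y').trans hE'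
  · exact isGramBoundedR_of_le (isGramBoundedR_softShaped_bgmFat_sharp (L := L) (M := M) B hAK hADt he hgap0 hlo hhi hβ0 m hlam0 hgradK p hAp hp)
      (Real.sqrt_nonneg _) (Real.sqrt_le_sqrt hE')
  · rw [← Real.sqrt_sq (norm_nonneg (sectorGramF L M β _ p Y))]
    exact Real.sqrt_le_sqrt ((norm_sq_sectorGramF_softShaped_bgmFat_sharp_le (L := L) (M := M) B hAK hADt he hgap0 hlo hhi hβ0 m hlam0 hgradK
      p hAp hp Y).trans hE')
  · rw [← Real.sqrt_sq (norm_nonneg (sectorGramG L M β _ p Y'))]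
    exact Real.sqrt_le_sqrt ((norm_sq_sectorGramG_softShaped_bgmFat_sharp_le (L := L) (M := M) B hAK hADt he hgap0 hlo hhi hβ0 m hlam0 hgradK
      p hAp hp Y').trans hE')

/-! ## §2 Under EXACTLY the binders of the engine stubs (`klEngC₃3 / klEngU₀4 / klEngL₃ / klEngM₃`) -/

/-- **β-UNIFORM line data of the fat-sectorised line of a soft-shaped symbol under the stub binders**: fat index `n` (`1 ≤ n ≤ nScales β + 1`), any
symbol `p` with `‖p(ks)‖ ≤ A_p·βL²/√(ω² + e_K²)` where `p(ks) ≠ 0` (`A_p ≥ 0`): entries `≤ A_p·Cκ·e₀·8^{-n}`, `IsGramBoundedR … √(A_p·Cκ·e₀·8^{-n})`, and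
`‖F_Y‖, ‖G_{Y′}‖ ≤ √(A_p·Cκ·e₀·8^{-n})` — p5's l.3059 `hent` / `hκF` / `hκG` for the dressed soft line (`A_p = 8` by `norm_klE5SoftLineSym_le`; the bare
soft covariance `klSoftCov n′` is the case `A_p = 1`, cf. `gram_klSoftCov_bgmFat_sharp_klEng`). [cite: BenfattoGiulianiMastropietro2006, §2.8 (2.80)] -/
theorem gram_softShaped_bgmFat_sharp_klEng :
    ∃ Cκ : ℝ, 0 < Cκ ∧ ∀ (P : SplitConsts) (R : RenConsts) (c : ℝ), P.WF → R.WF2 → 0 < c → c ≤ EngineV8.klEngC₃3 P R →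
      ∀ μ ∈ klWindowC, ∀ U : ℝ, 0 < U → U ≤ EngineV8.klEngU₀4 P R c → ∀ β : ℝ, klBetaMin ≤ β → β ≤ Real.exp (c / U ^ 2) →
      ∀ K : TrigPolyC4v, FrameOK R U (nScales β) μ K → ∀ (L M : ℕ) [NeZero L] [NeZero M],
      EngineV8.klEngL₃ β U ≤ L → EngineV8.klEngM₃ β U L ≤ M → ∀ n : ℕ, 1 ≤ n → n ≤ nScales β + 1 →
      ∀ (p : FreqMomentum L M × Fin 2 → ℂ) (Ap : ℝ), 0 ≤ Ap →
      (∀ ks, p ks ≠ 0 → ‖p ks‖ ≤ Ap * (β * (L : ℝ) ^ 2) / Real.sqrt (matsubaraFreq β M ks.1.1 ^ 2 + nambuXiCT L μ K ks.1.2 ^ 2)) →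
        (∀ Y Y' : SpaceTimeIdx L M × SectorLeg (sectorCount n),
          ‖((sectorSubMatrix L M β (bgmFatMultiplier L M klE0 β (nambuXiCT L μ K) n)).transpose *
              normalCovariance L M p * sectorSubMatrix L M β (bgmFatMultiplier L M klE0 β (nambuXiCT L μ K) n)) Y Y'‖ ≤
            Ap * Cκ * (klE0 * ((8 : ℝ) ^ n)⁻¹)) ∧
        IsGramBoundedR ((sectorSubMatrix L M β (bgmFatMultiplier L M klE0 β (nambuXiCT L μ K) n)).transpose *
              normalCovariance L M p * sectorSubMatrix L M β (bgmFatMultiplier L M klE0 β (nambuXiCT L μ K) n))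
          (Real.sqrt (Ap * Cκ * (klE0 * ((8 : ℝ) ^ n)⁻¹))) ∧
        (∀ Y : SpaceTimeIdx L M × SectorLeg (sectorCount n),
          ‖sectorGramF L M β (bgmFatMultiplier L M klE0 β (nambuXiCT L μ K) n) p Y‖ ≤ Real.sqrt (Ap * Cκ * (klE0 * ((8 : ℝ) ^ n)⁻¹))) ∧
        (∀ Y' : SpaceTimeIdx L M × SectorLeg (sectorCount n),
          ‖sectorGramG L M β (bgmFatMultiplier L M klE0 β (nambuXiCT L μ K) n) p Y'‖ ≤ Real.sqrt (Ap * Cκ * (klE0 * ((8 : ℝ) ^ n)⁻¹))) := by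
  have ha : (-4 : ℝ) < -(6 / 5) := by norm_num
  have hab : (-(6 / 5) : ℝ) ≤ -(1 / 10) := by norm_num
  have hb : (-(1 / 10) : ℝ) < 0 := by norm_num
  obtain ⟨Cκ, hCκ, h⟩ := gram_softShaped_bgmFat_sharp_of_thresholds ha hab hb
  refine ⟨Cκ, hCκ, ?_⟩
  intro P R c _ hR2 hc hc3 μ hμ U hU hU0 β hβmin hβc K hK L M _ _ hL3 _ n hn hnN p Ap hAp hp
  obtain ⟨m, rfl⟩ : ∃ m, n = m + 1 := ⟨n - 1, by omega⟩
  have hRj : ∀ j, 0 ≤ R.Gfr j := EngineV8.gfr_nonneg_of_wf2 hR2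
  exact h R hRj c U hc (hc3.trans (EngineV8.klEngC₃3_le_symbolC₃ ha hab hb P hRj)) hU
    ((hU0.trans (EngineV8.klEngU₀4_le_klEngU₀3 P R c)).trans (EngineV8.klEngU₀3_le_symbolU₀ ha hab hb P hRj c)) β hβmin hβc μ hμ K hK L M
    (EngineV8.sq_le_of_klEngL₃_le hL3) m (by omega) p Ap hAp hp

end Summit.HubbardSuperconductivity.HubbardSuperconductivity.Theorems.TorusFourierL2

end
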